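import Summits.BirchSwinnertonDyer.Rank1Residual.Supersingular.KobayashiMainConjecture
import Summits.BirchSwinnertonDyer.Rank1Residual.Supersingular.KobayashiSqueezeReal
import Literature.NumberTheory.EllipticCurves.Kobayashi2003.SignedColemanKatoZeta
import Literature.NumberTheory.EllipticCurves.Rank1Residual.PeriodUnitProofs
import Literature.NumberTheory.EllipticCurves.Kato2004.IwasawaCohomologyExistsProofs
import Literature.NumberTheory.EllipticCurves.Kato2004.IwasawaH1ProjZeroKernelProofs
import Literature.NumberTheory.EllipticCurves.KatoFineSelmerDualProofs
import Literature.NumberTheory.EllipticCurves.KatoFineSelmerFiniteProofs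
import Literature.NumberTheory.EllipticCurves.IwasawaAlgebraProofs
import Literature.NumberTheory.EllipticCurves.IwasawaAlgebraDivisibilityProofs
import Literature.NumberTheory.EllipticCurves.IwasawaAlgebraCharIdealProofs
import Literature.NumberTheory.EllipticCurves.IwasawaAlgebraRankOneIdealProofs
import HarnessLib

/-!
# Kobayashi 2003 Thm. 7.4 (ii) AT THE TRIVIAL CHARACTER, IN THE KERNEL: Kato's main conjecture for
# `T_pE` over `ℚ_∞`, read on the tree's `η = 1` Coleman/Kato package, gives `KobayashiMainConjecture W p ε`
# — and its Eisenstein half alone gives `KobayashiLowerDivisibility W p ε` (route `SignedLowerHalves`,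
# crux `KobayashiLowerHalfLargeImage` = item stmt-BirchSwinnertonDyer-19001, line `kurihara_rigidity`;
# cell `bsd-ssimc`, seat `bsd-line-slh-p1-w2`; a `--supports … --as helper` file)

WHAT. Line `kurihara_rigidity` (lead `bsd-line-slh-p1`, skeleton reshape r2) turns a Kurihara-number
certificate into Kato's main conjecture (C.-H. Kim, Amer. J. Math. 148 (2026) Thm. 1.11 (1) ⟹ (3);
Castella–Sano arXiv:2601.14504 Thm. 1, PREPRINT) and Kato's main conjecture into BOTH signed main
conjectures by S. Kobayashi, Invent. Math. 152 (2003) **Thm. 7.4** (p. 13: "The three conjectures,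
namely, Kato's main conjecture (Sect. 5), the even main conjecture and the odd main conjecture (Sect. 4)
are equivalent") at the trivial character (`F_∞ = ℚ_∞`). The lead's binder file
`Rank1Residual/Supersingular/KobayashiMainConjectureKuriharaRigidity.lean` (p606756) types «Kim 1.11 ∘
Kobayashi 7.4» and «CS Thm 1 ∘ Kobayashi 7.4» as COMPOSITE binders in the ± currency "because the tree has
no predicate «Kato's main conjecture for `E` at `p`»". THIS FILE makes the Kobayashi step a KERNEL
THEOREM, as cell `bsd-potss` did at the quadratic character `η` (`Thm74Skeleton.*`,
`KuriharaRoad.plusEtaMainConjectureAt_of_etaEisensteinFrame_of_surjective`): Kato's main conjecture IS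
statable on pinned objects of the tree — `I : Kato2004.IwasawaH1Data W p κ γ` (`𝐇¹(T)^Δ`),
`Y : W.FineSelmerDualData κ γ` (`X⁰(E/K_∞)^Δ ≅ 𝐇²(T)^Δ`, Kobayashi Prop. 7.1 ii)) and the zeta submodule
`d.Z` of a datum `d : Kobayashi2003.SignedColemanKatoData W p f ϖ κ γ ε I` of the ACCEPTED `η = 1` package
(seat `k3-c4x`; Thm. 6.2 (6.13)/(6.14) + Thm. 6.3 + Thm. 7.3 i) (7.21) + Kato Thm. 12.6) — as
`char_Λ(Y.X) = char_Λ(I.H ⧸ d.Z)` («`Char 𝐇²(T) = Char 𝐇¹(T)/Z(T)`», §5 p. 10); and the proof of Thm. 7.4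
("By Theorem 6.2, 6.3 and (7.21), we have three exact sequences `0 → 𝐇¹(T)^Δ/Z(T)^Δ → Λ^Δ/(L_p^−(E, X)) →
X^−(E/K_∞)^Δ → X⁰(E/K_∞)^Δ → 0` … The theorem follows from these sequences") is module theory over `Λ`.

* §1 `Λ`-ALGEBRA [folklore]: the four-term sequence `0 → 𝐇/Z → R/c(Z) → X → B → 0` for a zeta SUBMODULE
  `Z` (the `η`-twin `Thm74Skeleton.exists_fourTermExact_of_threeTermExact` has a line `R∙z`); equality of
  the local lengths `ℓ_𝔭(R/J₁) = ℓ_𝔭(R/J₂)` for ideals agreeing after localisation at `𝔭` (the currency of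
  the package field `image_zeta_localized`); `char A = char B ⟹ char X = char Q` and `char B ⊆ char A ⟹
  char X ⊆ char Q` along `0 → A → Q → X → B → 0` (`Module.charIdeal_eq_mul_of_exact`, twice).
* §2 FRAME THEOREMS for `W/ℚ` globally minimal, `p ≥ 5` good, `a_p = 0`, `E[p]` irreducible, sign `ε`,
  GRANTED Kobayashi Thm. 1.2 (`h12 : thm12_signedSelmerDual_finite_torsion`, PUBLISHED; torsion of `X^ε`,
  hence of `X₀`) and the period unit (`h5 : realPeriodRat_eq_unit_mul_plusPeriod`; to write the
  NÉRON-normalised `L_p^ε` as `C(u)·L ∈ Λ`): `kobayashiMainConjecture_of_katoMainConjectureFrame` — Kato's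
  main conjecture on the package (equality, displayed `hK`) ⟹ `KobayashiMainConjecture W p ε`;
  `kobayashiLowerDivisibility_of_katoEisensteinFrame` — its EISENSTEIN half `char Y.X ⊆ char(I.H ⧸ d.Z)`
  alone ⟹ `KobayashiLowerDivisibility W p ε`, the decl the crux asks for.

HONEST FRAMING (cell `bsd-ssimc`, HOME `run/shared/lean/pub/bsd-ssimc/`; D-0036/D-0074): TOOL THEOREMS
ONLY — no definition, no named fact minted, no `sorry`, axioms standard. The frames `hK` are DISPLAYED
(Kato's main conjecture is OPEN class-wide; the sibling `…KuriharaRigidityBinders.lean` supplies it from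
Kim Thm. 1.11 resp. Castella–Sano Thm. 1); `h12`, `h5` are named published facts. Nothing closes; crux,
line and route stay OPEN; BSD is not proved by any of this. `--supports stmt-BirchSwinnertonDyer-19001 --as helper`.

References: [Kobayashi2003] Thm. 1.2, §4–§5, Thm. 6.2/6.3, Prop. 7.1, Cor. 7.2, Thm. 7.3 (7.21), Thm. 7.4
(p. 13); [Kato2004Asterisque] §12.2, Thm. 12.4–12.6, Conj. 12.10; [GreenbergVatsal2000] §3 Rem. 3.4;
[Pollack2003] Cor. 5.11; [NeukirchSchmidtWingberg2008] Ch. V §3; [Washington1997] §13.2.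
-/

set_option autoImplicit false
-- single-problem summit (D-0017): the doubled namespace component is by design
set_option linter.dupNamespace false

noncomputable section

open scoped Classical MatrixGroups ModularForm

open CongruenceSubgroup Field WeierstrassCurve Literature.NumberTheory.EllipticCurves
  Literature.NumberTheory.EllipticCurves.ModularForms Literature.NumberTheory.GaloisRepresentations
  Literature.NumberTheory.EllipticCurves.Rank1Residual Summit.BirchSwinnertonDyer.Rank1Residual.Supersingular

namespace Summit.BirchSwinnertonDyer.BirchSwinnertonDyer.Theorems.KuriharaRigidity

/-! ## §1 `Λ`-algebra: the four-term sequence for a zeta SUBMODULE, local comparison of two ideals,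
characteristic ideals along `0 → A → Q → X → B → 0` -/

section Algebra

variable {R : Type} [CommRing R]
variable {H X B : Type} [AddCommGroup H] [Module R H] [AddCommGroup X] [Module R X]
  [AddCommGroup B] [Module R B]

/-- **`0 → H/Z → R/c(Z) → X → B → 0` from `H →ᶜ R →ʲ X →ᵏ B → 0`** (`c` injective, `k` onto, ANY
submodule `Z ≤ H`; maps induced by `c` and `j`, as `c(Z) ⊆ c(H) = ker j`): the passage "By Theorem 6.2,
6.3 and (7.21), we have three exact sequences `0 → 𝐇¹(T)^Δ/Z(T)^Δ → Λ^Δ/(L_p^−(E,X)) → X^−(E/K_∞)^Δ →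
X⁰(E/K_∞)^Δ → 0`" of the proof of Kobayashi's Thm. 7.4, submodule version of
`Thm74Skeleton.exists_fourTermExact_of_threeTermExact`. [cite: Kobayashi2003, proof of Thm. 7.4 (p. 13), Thm. 7.3 i) (7.21)] -/
theorem exists_fourTermExact_of_threeTermExact_submodule (c : H →ₗ[R] R) (j : R →ₗ[R] X)
    (k : X →ₗ[R] B) (hc : Function.Injective c) (hcj : Function.Exact c j)
    (hjk : Function.Exact j k) (hk : Function.Surjective k) (Z : Submodule R H) :
    ∃ (i : (H ⧸ Z) →ₗ[R] (R ⧸ (Z.map c : Ideal R)))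
      (j' : (R ⧸ (Z.map c : Ideal R)) →ₗ[R] X) (k' : X →ₗ[R] B),
      Function.Injective i ∧ Function.Exact i j' ∧ Function.Exact j' k' ∧
        Function.Surjective k' := by
  have hzc : Z ≤ Submodule.comap c (Z.map c) := Submodule.le_comap_map _ _
  have hcz : (Z.map c : Submodule R R) ≤ LinearMap.ker j := by
    rw [hcj.linearMap_ker_eq]
    exact LinearMap.map_le_range
  refine ⟨Submodule.mapQ _ _ c hzc, (Z.map c).liftQ j hcz, k, ?_, ?_, ?_, hk⟩
  · rw [← LinearMap.ker_eq_bot, Submodule.ker_mapQ, Submodule.comap_map_eq_of_injective hc,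
      Submodule.mkQ_map_self]
  · rw [LinearMap.exact_iff, Submodule.ker_liftQ, Submodule.range_mapQ, hcj.linearMap_ker_eq]
  · rw [LinearMap.exact_iff, Submodule.range_liftQ, hjk.linearMap_ker_eq]

/-- **`ℓ_𝔭(R/J₁) = ℓ_𝔭(R/(J₁ + J₂))` when `s·J₂ ⊆ J₁` for some `s ∉ 𝔭`**: the kernel `(J₁ + J₂)/J₁` is
killed by `s`, so dies at `𝔭` (`Module.lengthAt_eq_zero_of_isTorsionBy`); local length is additive
(`Module.lengthAt_eq_add_quotient`). [folklore] [cite: NeukirchSchmidtWingberg2008, Ch. V §1, (5.1.4) Remark 1] -/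
theorem lengthAt_quotient_eq_lengthAt_quotient_sup {J₁ J₂ : Ideal R} (𝔭 : PrimeSpectrum R) {s : R}
    (hs : s ∉ 𝔭.asIdeal) (h : ∀ x ∈ J₂, s * x ∈ J₁) :
    Module.lengthAt R (R ⧸ J₁) 𝔭 = Module.lengthAt R (R ⧸ (J₁ ⊔ J₂)) 𝔭 := by
  set M' : Submodule R (R ⧸ J₁) := Submodule.map J₁.mkQ (J₁ ⊔ J₂) with hM'
  have htors : Module.IsTorsionBy R M' s := by
    rintro ⟨m, hm⟩
    obtain ⟨x, hx, rfl⟩ := Submodule.mem_map.mp hm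
    obtain ⟨a, ha, b, hb, rfl⟩ := Submodule.mem_sup.mp hx
    rw [Subtype.ext_iff, Submodule.coe_smul, Submodule.coe_zero, ← map_smul, Submodule.mkQ_apply,
      Submodule.Quotient.mk_eq_zero, smul_eq_mul, mul_add]
    exact J₁.add_mem (J₁.mul_mem_left s ha) (h b hb)
  rw [Module.lengthAt_eq_add_quotient M' 𝔭, Module.lengthAt_eq_zero_of_isTorsionBy htors 𝔭 hs,
    zero_add]
  exact Module.lengthAt_eq_of_linearEquiv
    (Submodule.quotientQuotientEquivQuotient J₁ (J₁ ⊔ J₂) le_sup_left) 𝔭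

/-- **Ideals which agree after localisation at `𝔭` have quotients of the same local length**: if some
`s ∉ 𝔭` has `s·J₂ ⊆ J₁` and `s·J₁ ⊆ J₂`, then `ℓ_𝔭(R/J₁) = ℓ_𝔭(R/J₂)` — the currency of the field
`image_zeta_localized` of `Kobayashi2003.SignedColemanKatoData` (Thm. 6.3 on ideals, with Kato's
finite-index Thm. 12.6). [folklore] [cite: Kobayashi2003, Thm. 6.3 (p. 11)] [cite: Washington1997, §13.2] -/
theorem lengthAt_quotient_eq_of_localized {J₁ J₂ : Ideal R} (𝔭 : PrimeSpectrum R) {s : R}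
    (hs : s ∉ 𝔭.asIdeal) (h₂₁ : ∀ x ∈ J₂, s * x ∈ J₁) (h₁₂ : ∀ x ∈ J₁, s * x ∈ J₂) :
    Module.lengthAt R (R ⧸ J₁) 𝔭 = Module.lengthAt R (R ⧸ J₂) 𝔭 := by
  rw [lengthAt_quotient_eq_lengthAt_quotient_sup 𝔭 hs h₂₁,
    lengthAt_quotient_eq_lengthAt_quotient_sup 𝔭 hs h₁₂, sup_comm]

/-- `R/J` is a torsion module over a domain `R` as soon as `J` contains a non-zero element. [folklore] -/
theorem isTorsion_quotient_of_mem [IsDomain R] {J : Ideal R} {a : R} (ha : a ∈ J) (ha0 : a ≠ 0) :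
    Module.IsTorsion R (R ⧸ J) := by
  intro x
  refine ⟨⟨a, mem_nonZeroDivisors_of_ne_zero ha0⟩, ?_⟩
  obtain ⟨r, rfl⟩ := Submodule.Quotient.mk_surjective J x
  rw [Submonoid.smul_def, ← Submodule.Quotient.mk_smul, Submodule.Quotient.mk_eq_zero, smul_eq_mul]
  exact J.mul_mem_right r ha

/-- The image of a torsion module under a surjective linear map is torsion (a torsion class of
Kobayashi's `X^ε` pushes forward along `X^ε ↠ X₀`). [folklore] -/
theorem isTorsion_of_surjective {Q : Type} [AddCommGroup Q] [Module R Q] (hX : Module.IsTorsion R X)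
    (k : X →ₗ[R] Q) (hk : Function.Surjective k) : Module.IsTorsion R Q := by
  intro q
  obtain ⟨x, rfl⟩ := hk q
  obtain ⟨s, hs⟩ := @hX x
  exact ⟨s, by rw [Submonoid.smul_def, ← map_smul, ← Submonoid.smul_def, hs, map_zero]⟩

/-- **Characteristic ideals along `0 → A → Q → X → B → 0`** (Noetherian domain; `Q`, `B` finitely
generated torsion): `char Q = char A·char Q'`, `char X = char Q'·char B` for the image `Q'` of `Q`
(`Module.charIdeal_eq_mul_of_exact`), whence `char A = char B ⟹ char X = char Q` and `char B ⊆ char A ⟹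
char X ⊆ char Q` — "The theorem follows from these sequences" (proof of Kobayashi's Thm. 7.4).
[cite: Kobayashi2003, proof of Thm. 7.4 (p. 13)] [cite: NeukirchSchmidtWingberg2008, Ch. V §3] -/
theorem charIdeal_eq_of_fourTermExact [IsNoetherianRing R] [IsDomain R]
    {A Q : Type} [AddCommGroup A] [Module R A] [AddCommGroup Q] [Module R Q]
    [Module.Finite R Q] [Module.Finite R B]
    (hQ : Module.IsTorsion R Q) (hB : Module.IsTorsion R B)
    (f : A →ₗ[R] Q) (g : Q →ₗ[R] X) (h : X →ₗ[R] B)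
    (hf : Function.Injective f) (hfg : Function.Exact f g) (hgh : Function.Exact g h)
    (hh : Function.Surjective h) :
    (Module.charIdeal R A = Module.charIdeal R B → Module.charIdeal R X = Module.charIdeal R Q) ∧
    (Module.charIdeal R B ≤ Module.charIdeal R A → Module.charIdeal R X ≤ Module.charIdeal R Q) := by
  set Q' : Submodule R X := LinearMap.range g with hQ'def
  have h1 : Function.Exact f g.rangeRestrict := by
    rw [LinearMap.exact_iff, LinearMap.ker_rangeRestrict, hfg.linearMap_ker_eq]
  have h2 : Function.Exact Q'.subtype h := by
    rw [LinearMap.exact_iff, hgh.linearMap_ker_eq, Submodule.range_subtype]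
  have hQ'tors : Module.IsTorsion R Q' :=
    isTorsion_of_surjective hQ g.rangeRestrict (LinearMap.surjective_rangeRestrict g)
  haveI : Module.Finite R X := Module.Finite.of_exact h2 hh
  have hXt : Module.IsTorsion R X := by
    intro x
    obtain ⟨s, hs⟩ := @hB (h x)
    have hx : s.1 • x ∈ LinearMap.range g := by
      rw [← hgh.linearMap_ker_eq, LinearMap.mem_ker, map_smul]
      exact hs
    obtain ⟨q, hq⟩ := hx
    obtain ⟨t, ht⟩ := @hQ q
    refine ⟨t * s, ?_⟩
    rw [Submonoid.smul_def, Submonoid.coe_mul, mul_smul, ← hq, ← map_smul, ← Submonoid.smul_def, ht,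
      map_zero]
  have e1 : Module.charIdeal R Q = Module.charIdeal R A * Module.charIdeal R Q' :=
    Module.charIdeal_eq_mul_of_exact hQ f g.rangeRestrict hf (LinearMap.surjective_rangeRestrict g) h1
  have e2 : Module.charIdeal R X = Module.charIdeal R Q' * Module.charIdeal R B :=
    Module.charIdeal_eq_mul_of_exact hXt Q'.subtype h (Submodule.injective_subtype Q') hh h2
  constructor
  · intro hAB
    rw [e2, e1, ← hAB, mul_comm]
  · intro hBA
    rw [e2, e1, mul_comm (Module.charIdeal R A)]
    exact Ideal.mul_mono_right hBA

end Algebra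

/-! ## §2 Kobayashi's Thm. 7.4 (ii) at `η = 1` in the kernel: Kato's main conjecture (resp. its Eisenstein
half), read on the `η = 1` Coleman/Kato package, gives `KobayashiMainConjecture W p ε` (resp.
`KobayashiLowerDivisibility W p ε`) -/

section Frame

variable (W : WeierstrassCurve ℚ) [W.IsElliptic] [W.IsGloballyMinimal] (p : ℕ) [Fact p.Prime]
  [ContinuousSMul ℤ_[p] (W.tateModule p)] [Module.Free ℤ_[p] (W.tateModule p)]
  [Module.Finite ℤ_[p] (W.tateModule p)]

/-- **Common core of the two frame theorems** (Kobayashi p. 13 at `η = 1`, data assembly): for a frame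
of `KobayashiMainConjecture W p ε` (cyclotomic `(κ, γ)`, newform `f`, period ratio `ϖ`, Pollack pair, dual
datum `D`), a pinned fine dual `Y` and a package datum `d` on a pinned `I`, at a good `p ≥ 5` with
`a_p = 0` and `E[p]` irreducible, GRANTED Thm. 1.2 (`h12`) and the period unit (`h5`): `D.X` and `Y.X` are
torsion, and there are `G₁ ∈ Λ` with `ι G₁ = C(ϖ)·ι L^ε` (`L^ε = kobayashiL ε L⁺ L⁻`, NÉRON-normalised
`L_p^ε`), `char(Λ/col Z) = (G₁)` with `Λ/col Z` torsion, and the exact `0 → I.H/d.Z → Λ/col Z → D.X →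
Y.X → 0`. [cite: Kobayashi2003, proof of Thm. 7.4 (p. 13), Thm. 7.3 i) (7.21), Thm. 6.3 (p. 11), Thm. 1.2 (p. 2), (3.4)–(3.6) (p. 7)]
[cite: GreenbergVatsal2000, §3, Remark 3.4] [cite: Pollack2003, Cor. 5.11 and Prop. 6.18] -/
theorem exists_fourTerm_data_of_signedColemanKato
    (h12 : Kobayashi2003.thm12_signedSelmerDual_finite_torsion)
    (h5 : realPeriodRat_eq_unit_mul_plusPeriod)
    (hp5 : 5 ≤ p) (hgood : W.HasGoodReductionAtPrime p) (hap : W.frobeniusTrace p = 0)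
    (hirr : W.HasIrreducibleModPGaloisRep p) {ε : ℤˣ}
    {κ : ZpExtension ℚ p} {γ : absoluteGaloisGroup ℚ} (hκ : κ.IsCyclotomic) (hγ : κ.IsTopGenerator γ)
    {N : ℕ} [NeZero N] {f : CuspForm (Gamma0 N) 2} (hf : IsNewformOf W f)
    {ϖ : ℚ} (hϖ : (ϖ : ℝ) * W.realPeriodRat = plusPeriod f)
    {Lplus Lminus : IwasawaAlgebra p} (hL : IsPollackPair f p Lplus Lminus)
    (D : Kobayashi2003.SignedSelmerDualData W κ γ ε) {I : Kato2004.IwasawaH1Data W p κ γ}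
    (Y : W.FineSelmerDualData κ γ) (d : Kobayashi2003.SignedColemanKatoData W p f ϖ κ γ ε I) :
    Module.IsTorsion (IwasawaAlgebra p) D.X ∧ Module.IsTorsion (IwasawaAlgebra p) Y.X ∧
    ∃ G₁ : IwasawaAlgebra p,
      iwasawaToPowerSeries p G₁ =
        PowerSeries.C ((ϖ : ℚ) : ℚ_[p]) * iwasawaToPowerSeries p (kobayashiL ε Lplus Lminus) ∧
      Module.charIdeal (IwasawaAlgebra p) (IwasawaAlgebra p ⧸ (d.Z.map d.col : Ideal (IwasawaAlgebra p))) =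
        Ideal.span {G₁} ∧
      Module.IsTorsion (IwasawaAlgebra p) (IwasawaAlgebra p ⧸ (d.Z.map d.col : Ideal (IwasawaAlgebra p))) ∧
      ∃ (i : (I.H ⧸ d.Z) →ₗ[IwasawaAlgebra p]
            (IwasawaAlgebra p ⧸ (d.Z.map d.col : Ideal (IwasawaAlgebra p))))
        (j' : (IwasawaAlgebra p ⧸ (d.Z.map d.col : Ideal (IwasawaAlgebra p))) →ₗ[IwasawaAlgebra p] D.X)
        (k' : D.X →ₗ[IwasawaAlgebra p] Y.X),
        Function.Injective i ∧ Function.Exact i j' ∧ Function.Exact j' k' ∧ Function.Surjective k' := by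
  have hpP : p.Prime := Fact.out
  have hp2 : p ≠ 2 := by omega
  -- Kobayashi Thm. 1.2: `X^ε` is finitely generated torsion
  obtain ⟨-, hDtor⟩ := h12 W p hp2 hgood hap κ γ hκ hγ ε D
  -- Kobayashi's `L_p^ε` (non-zero, Pollack) and its Néron normalisation `G₁ = C(u)·L ∈ Λ`
  set L : IwasawaAlgebra p := kobayashiL ε Lplus Lminus with hLdef
  have hLsgn : Kobayashi2003.IsSignedPAdicLFunction f p ε L := hL.isSignedPAdicLFunction_kobayashiL ε
  have hL0 : L ≠ 0 := by
    rw [hLdef, kobayashiL]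
    split_ifs
    · exact hL.2.1
    · exact hL.1
  have hϖ0 : ϖ ≠ 0 := by
    rintro rfl
    rw [Rat.cast_zero, zero_mul] at hϖ
    exact (IsNewform0.plusPeriod_pos_holds hf.1 hf.coeffField_eq_bot).ne hϖ
  have hvϖ : padicValRat p ϖ = 0 :=
    Rank1Residual.padicValRat_periodRatio_eq_zero_of_five_le h5 W p hp5 hgood hirr f hf ϖ hϖ
  obtain ⟨u, hu⟩ := exists_units_coe_eq_ratCast hϖ0 hvϖ
  set G₁ : IwasawaAlgebra p := PowerSeries.C (u : ℤ_[p]) * L with hG₁def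
  have hG₁ : iwasawaToPowerSeries p G₁ =
      PowerSeries.C (((ϖ : ℚ) : ℚ_[p])) * iwasawaToPowerSeries p L := by
    rw [hG₁def, map_mul, ← hu]
    congr 1
    rw [PowerSeries.map_C]
    rfl
  have hCu : (PowerSeries.C (u : ℤ_[p]) : IwasawaAlgebra p) ≠ 0 := by
    rw [Ne, ← map_zero (PowerSeries.C (R := ℤ_[p])), (PowerSeries.C_injective).eq_iff]
    exact Units.ne_zero u
  have hG₁0 : G₁ ≠ 0 := mul_ne_zero hCu hL0
  -- `J = col(Z)`; `char(Λ/J) = (G₁)` from Thm. 6.3 on ideals at every height-one prime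
  set J : Ideal (IwasawaAlgebra p) := d.Z.map d.col with hJdef
  have hloc : ∀ 𝔭 : PrimeSpectrum (IwasawaAlgebra p), 𝔭.asIdeal.height = 1 →
      ∃ s : IwasawaAlgebra p, s ∉ 𝔭.asIdeal ∧ s * G₁ ∈ J ∧
        ∀ x ∈ J, s * x ∈ Ideal.span {G₁} := by
    intro 𝔭 h𝔭
    obtain ⟨s, hs𝔭, hsG, hsZ⟩ := d.image_zeta_localized hirr L G₁ hLsgn hG₁ 𝔭 h𝔭
    refine ⟨s, hs𝔭, hsG, fun x hx => ?_⟩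
    obtain ⟨z, hz, rfl⟩ := Submodule.mem_map.mp hx
    exact hsZ z hz
  have hcharJ : Module.charIdeal (IwasawaAlgebra p) (IwasawaAlgebra p ⧸ J) = Ideal.span {G₁} := by
    rw [← Module.charIdeal_quotient_span_singleton hG₁0]
    unfold Module.charIdeal
    refine finprod_mem_congr rfl fun 𝔭 h𝔭 => ?_
    obtain ⟨s, hs𝔭, hsG, hsJ⟩ := hloc 𝔭 h𝔭
    rw [lengthAt_quotient_eq_of_localized 𝔭 hs𝔭 (J₁ := J) (J₂ := Ideal.span {G₁}) ?_ hsJ]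
    intro x hx
    obtain ⟨r, rfl⟩ := Ideal.mem_span_singleton'.mp hx
    rw [← mul_assoc, mul_comm s r, mul_assoc]
    exact J.mul_mem_left r hsG
  -- `Λ/J` is torsion: `J ∋ s₀·G₁ ≠ 0` at the height-one prime `(p)`
  let 𝔭₀ : PrimeSpectrum (IwasawaAlgebra p) :=
    ⟨IwasawaAlgebra.augIdealP p, IwasawaAlgebra.isPrime_augIdealP_holds p⟩
  obtain ⟨s₀, hs₀, hs₀G, -⟩ := hloc 𝔭₀ (by exact IwasawaAlgebra.height_augIdealP_holds p)
  have hs₀0 : s₀ ≠ 0 := by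
    rintro rfl
    exact hs₀ (zero_mem _)
  have hQtor : Module.IsTorsion (IwasawaAlgebra p) (IwasawaAlgebra p ⧸ J) :=
    isTorsion_quotient_of_mem hs₀G (mul_ne_zero hs₀0 hG₁0)
  -- (7.21) for `D`, `Y`, and the four-term sequence
  obtain ⟨j, k, hcj, hjk, hk⟩ := d.exact D Y
  obtain ⟨i, j', k', hi, hij, hjk', hk'⟩ :=
    exists_fourTermExact_of_threeTermExact_submodule d.col j k d.col_injective hcj hjk hk d.Z
  exact ⟨hDtor, isTorsion_of_surjective hDtor k' hk', G₁, hG₁, hcharJ, hQtor, i, j', k', hi, hij, hjk',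
    hk'⟩

/-- **Kobayashi 2003 Thm. 7.4 (ii), «Kato's main conjecture ⟹ the signed main conjecture of sign `ε`», AT
`η = 1`, IN THE KERNEL.** `W/ℚ` globally minimal, `p ≥ 5` good with `a_p = 0`, `E[p]` irreducible, `ε` a
sign; GRANTED Kobayashi Thm. 1.2 (`h12`) and the period unit (`h5`), both PUBLISHED. DISPLAYED FRAME `hK` =
KATO'S MAIN CONJECTURE for `T_pE` over `ℚ_∞` read on the `η = 1` package: for the cyclotomic `(κ, γ)`
matching the variable, the newform `f` at level `N_E`, the period ratio `ϖ`, and ALL pinned `I`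
(`𝐇¹(T)^Δ`), `Y` (`X⁰(E/K_∞)^Δ ≅ 𝐇²(T)^Δ`, Prop. 7.1 ii)), SOME package datum `d` (Thm. 6.2/6.3/7.3 i) +
Kato 12.6) has `char_Λ(Y.X) = char_Λ(I.H ⧸ d.Z)` («`Char 𝐇²(T) = Char 𝐇¹(T)/Z(T)`», §5 p. 10 = Kato's
Conj. 12.10 = Kim's Conj. 1.3, up to the finite index of Thm. 12.6 which characteristic ideals do not see).
CONCLUSION `KobayashiMainConjecture W p ε`. Proof = `exists_fourTerm_data_of_signedColemanKato` +
`charIdeal_eq_of_fourTermExact`. CONDITIONAL on `hK`, `h12`, `h5`; closes nothing.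
[cite: Kobayashi2003, Thm. 7.4 and its proof (p. 13), §5 (p. 10), §4 (p. 8)]
[cite: Kato2004Asterisque, Conj. 12.10 (p. 224)] [cite: NeukirchSchmidtWingberg2008, Ch. V §3] -/
theorem kobayashiMainConjecture_of_katoMainConjectureFrame
    (h12 : Kobayashi2003.thm12_signedSelmerDual_finite_torsion)
    (h5 : realPeriodRat_eq_unit_mul_plusPeriod)
    (hp5 : 5 ≤ p) (hgood : W.HasGoodReductionAtPrime p) (hap : W.frobeniusTrace p = 0)
    (hirr : W.HasIrreducibleModPGaloisRep p) (ε : ℤˣ)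
    (hK : ∀ (κ : ZpExtension ℚ p) (γ : absoluteGaloisGroup ℚ),
        κ.IsCyclotomic → κ.IsTopGenerator γ → IsCyclotomicVariable p γ →
      ∀ [NeZero (W.conductorNorm ℤ)] (f : CuspForm (Gamma0 (W.conductorNorm ℤ)) 2),
        IsNewformOf W f → ∀ (ϖ : ℚ), (ϖ : ℝ) * W.realPeriodRat = plusPeriod f →
      ∀ (I : Kato2004.IwasawaH1Data W p κ γ) (Y : W.FineSelmerDualData κ γ),
        ∃ d : Kobayashi2003.SignedColemanKatoData W p f ϖ κ γ ε I,
          Module.charIdeal (IwasawaAlgebra p) Y.X =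
            Module.charIdeal (IwasawaAlgebra p) (I.H ⧸ d.Z)) :
    KobayashiMainConjecture W p ε := by
  intro κ γ hκ hγ hγc _ f hf ϖ hϖ Lplus Lminus hL D
  -- pin `𝐇¹_Γ(T_pW)` and `X₀(W/ℚ_∞)`, take the package datum carrying Kato's main conjecture
  obtain ⟨I⟩ := Kato2004.nonempty_iwasawaH1Data_holds W p κ γ hκ hγ
  obtain ⟨Y⟩ := W.nonempty_fineSelmerDualData κ hγ
  haveI : Module.Finite (IwasawaAlgebra p) Y.X :=
    WeierstrassCurve.FineSelmerDualData.module_finite _ κ hγ Y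
  obtain ⟨d, hIMC⟩ := hK κ γ hκ hγ hγc f hf ϖ hϖ I Y
  obtain ⟨hDtor, hYtor, G₁, hG₁, hcharJ, hQtor, i, j', k', hi, hij, hjk', hk'⟩ :=
    exists_fourTerm_data_of_signedColemanKato W p h12 h5 hp5 hgood hap hirr hκ hγ hf hϖ hL D Y d
  have hchar := (charIdeal_eq_of_fourTermExact hQtor hYtor i j' k' hi hij hjk' hk').1 hIMC.symm
  refine ⟨hDtor, G₁, ?_, hG₁⟩
  change Module.charIdeal (IwasawaAlgebra p) D.X = Ideal.span {G₁}
  rw [hchar, hcharJ]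

/-- **The EISENSTEIN half: Kato's LOWER inclusion `Char X₀ ⊆ Char(𝐇¹/Z)` on the `η = 1` package ⟹
`KobayashiLowerDivisibility W p ε`** — the decl the crux `KobayashiLowerHalfLargeImage` asks for (one
sign). Same frame as `kobayashiMainConjecture_of_katoMainConjectureFrame`, displayed hypothesis weakened to
`char_Λ(Y.X) ⊆ char_Λ(I.H ⧸ d.Z)` (the half Kato's Euler system does NOT give; the `⊇` half — Kato Thm.
12.5 (4) / Kobayashi Thm. 5.2 v) under the onto tower — is not used). Along the four-term sequence
`Char X^ε ⊆ char(Λ/col Z) = (ϖ·L_p^ε)`, and `Char X^ε = (g)` is principal (`charIdeal_isPrincipal_holds`), so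
`ι g = ϖ·ι(L_p^ε·h)`. CONDITIONAL on `hK`, `h12`, `h5`; closes nothing.
[cite: Kobayashi2003, proof of Thm. 7.4 (p. 13), §4 (p. 8)] [cite: Kato2004Asterisque, Conj. 12.10 (p. 224), Thm. 12.5 (4) (p. 222)]
[cite: NeukirchSchmidtWingberg2008, Ch. V §3] -/
theorem kobayashiLowerDivisibility_of_katoEisensteinFrame
    (h12 : Kobayashi2003.thm12_signedSelmerDual_finite_torsion)
    (h5 : realPeriodRat_eq_unit_mul_plusPeriod)
    (hp5 : 5 ≤ p) (hgood : W.HasGoodReductionAtPrime p) (hap : W.frobeniusTrace p = 0)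
    (hirr : W.HasIrreducibleModPGaloisRep p) (ε : ℤˣ)
    (hK : ∀ (κ : ZpExtension ℚ p) (γ : absoluteGaloisGroup ℚ),
        κ.IsCyclotomic → κ.IsTopGenerator γ → IsCyclotomicVariable p γ →
      ∀ [NeZero (W.conductorNorm ℤ)] (f : CuspForm (Gamma0 (W.conductorNorm ℤ)) 2),
        IsNewformOf W f → ∀ (ϖ : ℚ), (ϖ : ℝ) * W.realPeriodRat = plusPeriod f →
      ∀ (I : Kato2004.IwasawaH1Data W p κ γ) (Y : W.FineSelmerDualData κ γ),
        ∃ d : Kobayashi2003.SignedColemanKatoData W p f ϖ κ γ ε I,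
          Module.charIdeal (IwasawaAlgebra p) Y.X ≤
            Module.charIdeal (IwasawaAlgebra p) (I.H ⧸ d.Z)) :
    KobayashiLowerDivisibility W p ε := by
  intro κ γ hκ hγ hγc _ f hf ϖ hϖ Lplus Lminus hL D
  obtain ⟨I⟩ := Kato2004.nonempty_iwasawaH1Data_holds W p κ γ hκ hγ
  obtain ⟨Y⟩ := W.nonempty_fineSelmerDualData κ hγ
  haveI : Module.Finite (IwasawaAlgebra p) Y.X :=
    WeierstrassCurve.FineSelmerDualData.module_finite _ κ hγ Y
  obtain ⟨d, hEis⟩ := hK κ γ hκ hγ hγc f hf ϖ hϖ I Y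
  obtain ⟨-, hYtor, G₁, hG₁, hcharJ, hQtor, i, j', k', hi, hij, hjk', hk'⟩ :=
    exists_fourTerm_data_of_signedColemanKato W p h12 h5 hp5 hgood hap hirr hκ hγ hf hϖ hL D Y d
  have hle := (charIdeal_eq_of_fourTermExact hQtor hYtor i j' k' hi hij hjk' hk').2 hEis
  rw [hcharJ] at hle
  -- `Char X^ε = (g)` is principal and `(g) ⊆ (G₁)`: `g = G₁ · h`
  obtain ⟨g, hg⟩ := (charIdeal_isPrincipal_holds p D.X).principal
  have hg' : Module.charIdeal (IwasawaAlgebra p) D.X = Ideal.span {g} := hg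
  rw [hg', Ideal.span_singleton_le_iff_mem, Ideal.mem_span_singleton'] at hle
  obtain ⟨h, hh⟩ := hle
  refine ⟨g, h, ?_, ?_⟩
  · change Module.charIdeal (IwasawaAlgebra p) D.X = Ideal.span {g}
    exact hg'
  · rw [← hh, mul_comm h G₁, map_mul, hG₁, map_mul, mul_assoc]

end Frame

end Summit.BirchSwinnertonDyer.BirchSwinnertonDyer.Theorems.KuriharaRigidity

end
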